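/-
Copyright: the b2b-balaban cell (near-miss cell 7), T⁴-continuum fan-out, lineage t4-ne7b-p1 (node U5c COUNT member).
Released under the licence of the surrounding project.
-/
import Summits.QuantumFields.BalabanUV.T4Continuum.Support.ZoneDrivers

/-!
# Zone transport: genealogies along an injection of event types (finite alphabet ↔ the dictionary's `PEv`)

Summits-side support leaf of the T⁴-continuum cell (rung (B)+1 on a FINITE torus only; NOT infinite volume, NOT the
mass gap, NOT the Clay statement; NOT a proof of the spine estimate NE7b).  Lineage `t4-ne7b-p1`, node U5c, wall (GM),
located item G-ne7bp1g18-2 part (I).  [folklore] structural bookkeeping; nothing quoted, nothing printed asserted.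

WHY.  The counting theorems of the skeletons (`PlacementSkeleton.card_admSet_le_weight`, `ZoneSkeleton.card_admZSet_le`,
`ZoneDrivers.card_admZSet_root_le_crowd`) count placements `ε → γ` and so ask for a FINITE event type `ε`, while the
count chain's binders (`hlabM`∕`hlabF`∕`hlabG`∕`hlabZ`) quantify over genealogies on the dictionary's INFINITE alphabet
`PEv = ℕ × Fin 3 × ℕ`.  The instantiation therefore counts over the finite alphabet in play (a `Finset PEv` coerced to a
type, e.g. the dictionary's `dictE`) and maps into `Gen PEv`.  This file is the transport: `gmap f` pushes a genealogy
along `f : ε → ε'`, `grestrict` pulls a `Gen ε'` whose events lie in a finset `E` back to `Gen ↥E`, and every quantity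
of the skeletons and of the chain is invariant (`rootStep`, `reach`, `partnerAges`, `mergeCount`, `mergeProd`, `qZ`,
`Chrono`, `Separated`, `WF`, `events`∕`births`∕`merges` as images) for injective `f`.

HONEST DEPENDENCY (cell): continuum YM on T⁴ ⇐ BetaPertH ∧ nine spine estimates (0/9 proved); BetaPertH ⇐ (D1) ∧ (D4)
∧ CAP+tail.  This file changes none of it.
-/

open Finset
open Literature.MathematicalPhysics.QuantumFieldTheory.Balaban1983to89
open T4PersistenceDictionary T4PartnerMultiplicity
open Summit.QuantumFields.BalabanUV.T4Continuum.PlacementSkeleton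
open Summit.QuantumFields.BalabanUV.T4Continuum.Crowding

namespace Summit.QuantumFields.BalabanUV.T4Continuum.ZoneSkeleton

noncomputable section

variable {ε ε' : Type*}

/-! ## §1 Push-forward along a map of events -/

/-- PUSH-FORWARD of a genealogy along a map of events (steps and readiness indices unchanged). [folklore] -/
def gmap (f : ε → ε') : Gen ε → Gen ε'
  | Gen.born b j => Gen.born (f b) j
  | Gen.renew G e h => Gen.renew (gmap f G) (f e) h
  | Gen.merge X Y e => Gen.merge (gmap f X) (gmap f Y) (f e)

/-- root step is invariant [folklore] -/
@[simp] theorem rootStep_gmap (f : ε → ε') : ∀ G : Gen ε, (gmap f G).rootStep = G.rootStep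
  | Gen.born _ _ => rfl
  | Gen.renew G _ _ => by simp [gmap, rootStep_gmap f G]
  | Gen.merge X Y _ => by simp [gmap, rootStep_gmap f X, rootStep_gmap f Y]

/-- the root is mapped [folklore] -/
@[simp] theorem root_gmap (f : ε → ε') : ∀ G : Gen ε, (gmap f G).root = f G.root
  | Gen.born _ _ => rfl
  | Gen.renew G _ _ => by simp [gmap, Gen.root, root_gmap f G]
  | Gen.merge X Y e => by
      show (if (gmap f X).rootStep ≤ (gmap f Y).rootStep then (gmap f X).root else (gmap f Y).root) =
        f (if X.rootStep ≤ Y.rootStep then X.root else Y.root)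
      rw [rootStep_gmap, rootStep_gmap, root_gmap f X, root_gmap f Y]
      split_ifs <;> rfl

/-- the reach against a window table `W'` is the reach against `W' ∘ f` [folklore] -/
@[simp] theorem reach_gmap (f : ε → ε') (W' : ε' → ℕ) : ∀ G : Gen ε, (gmap f G).reach W' = G.reach (W' ∘ f)
  | Gen.born _ _ => rfl
  | Gen.renew G _ _ => by simp [gmap]
  | Gen.merge X Y _ => by simp [gmap, reach_gmap f W' X, reach_gmap f W' Y]

variable [DecidableEq ε] [DecidableEq ε']

/-- events are mapped [folklore] -/
@[simp] theorem events_gmap (f : ε → ε') : ∀ G : Gen ε, (gmap f G).events = G.events.image f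
  | Gen.born _ _ => by simp [gmap]
  | Gen.renew G e _ => by simp [gmap, events_gmap f G, image_insert]
  | Gen.merge X Y e => by simp [gmap, events_gmap f X, events_gmap f Y, image_insert, image_union]

/-- births are mapped [folklore] -/
@[simp] theorem births_gmap (f : ε → ε') : ∀ G : Gen ε, births (gmap f G) = (births G).image f
  | Gen.born _ _ => by simp [gmap]
  | Gen.renew G _ _ => by simp [gmap, births_gmap f G]
  | Gen.merge X Y _ => by simp [gmap, births_gmap f X, births_gmap f Y, image_union]

/-- mergers are mapped [folklore] -/
@[simp] theorem merges_gmap (f : ε → ε') : ∀ G : Gen ε, merges (gmap f G) = (merges G).image f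
  | Gen.born _ _ => by simp [gmap, merges]
  | Gen.renew G _ _ => by simp [gmap, merges, merges_gmap f G]
  | Gen.merge X Y e => by simp [gmap, merges, merges_gmap f X, merges_gmap f Y, image_insert, image_union]

/-- formation events are mapped [folklore] -/
@[simp] theorem form_gmap (f : ε → ε') (G : Gen ε) : form (gmap f G) = (form G).image f := by
  simp [form, image_union]

omit [DecidableEq ε] [DecidableEq ε'] in
/-- the placement exponent is invariant (`st' ∘ f` on the source) [folklore] -/
@[simp] theorem partnerAges_gmap (f : ε → ε') (st' : ε' → ℕ) :
    ∀ G : Gen ε, partnerAges st' (gmap f G) = partnerAges (st' ∘ f) G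
  | Gen.born _ _ => rfl
  | Gen.renew G _ _ => by simp [gmap, partnerAges_gmap f st' G]
  | Gen.merge X Y e => by simp [gmap, partnerAges_gmap f st' X, partnerAges_gmap f st' Y]

omit [DecidableEq ε] [DecidableEq ε'] in
/-- the number of merge nodes is invariant [folklore] -/
@[simp] theorem mergeCount_gmap (f : ε → ε') : ∀ G : Gen ε, mergeCount (gmap f G) = mergeCount G
  | Gen.born _ _ => rfl
  | Gen.renew G _ _ => by simp [gmap, mergeCount, mergeCount_gmap f G]
  | Gen.merge X Y _ => by simp [gmap, mergeCount, mergeCount_gmap f X, mergeCount_gmap f Y]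

omit [DecidableEq ε] [DecidableEq ε'] in
/-- structural products pull back [folklore] -/
theorem mergeProd_gmap (f : ε → ε') (g : Gen ε' → ε' → ℝ) :
    ∀ G : Gen ε, mergeProd g (gmap f G) = mergeProd (fun Z e => g (gmap f Z) (f e)) G
  | Gen.born _ _ => rfl
  | Gen.renew G _ _ => by simp [gmap, mergeProd, mergeProd_gmap f g G]
  | Gen.merge X Y e => by simp [gmap, mergeProd, mergeProd_gmap f g X, mergeProd_gmap f g Y]

omit [DecidableEq ε] [DecidableEq ε'] in
/-- step data pull back [folklore] -/
theorem stepsOK_gmap (f : ε → ε') (st' : ε' → ℕ) : ∀ {G : Gen ε}, StepsOK (st' ∘ f) G → StepsOK st' (gmap f G)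
  | Gen.born _ _, h => h
  | Gen.renew G _ _, h => stepsOK_gmap f st' (G := G) h
  | Gen.merge _ _ _, h => ⟨stepsOK_gmap f st' h.1, stepsOK_gmap f st' h.2⟩

omit [DecidableEq ε] [DecidableEq ε'] in
/-- order pulls back [folklore] -/
theorem ordered_gmap (f : ε → ε') (st' : ε' → ℕ) : ∀ {G : Gen ε}, Ordered (st' ∘ f) G → Ordered st' (gmap f G)
  | Gen.born _ _, _ => trivial
  | Gen.renew G _ _, h => ordered_gmap f st' (G := G) h
  | Gen.merge X Y e, h => by
      refine ⟨ordered_gmap f st' h.1, ordered_gmap f st' h.2.1, ?_, ?_⟩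
      · simpa [gmap] using h.2.2.1
      · simpa [gmap] using h.2.2.2

/-- the discounted weighted activity pulls back along an injection [folklore] -/
theorem qZ_gmap {f : ε → ε'} (hf : Function.Injective f) (wt' : ε' → ℝ) (σ : ℝ) (st' : ε' → ℕ) (G : Gen ε)
    (t : ℕ) : qZ wt' σ st' (gmap f G) t = qZ (wt' ∘ f) σ (st' ∘ f) G t := by
  unfold qZ
  rw [form_gmap, sum_image fun _ _ _ _ h => hf h]
  rfl

/-- chronology pushes forward [folklore] -/
theorem chrono_gmap (f : ε → ε') (st' : ε' → ℕ) : ∀ {G : Gen ε}, Chrono (st' ∘ f) G → Chrono st' (gmap f G)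
  | Gen.born _ _, _ => trivial
  | Gen.renew G _ _, h => chrono_gmap f st' (G := G) h
  | Gen.merge X Y e, h => by
      refine ⟨chrono_gmap f st' h.1, chrono_gmap f st' h.2.1, fun w hw => ?_⟩
      simp only [form_gmap, ← image_union, mem_image] at hw
      obtain ⟨w₀, hw₀, rfl⟩ := hw
      exact h.2.2 w₀ hw₀

/-- separation pushes forward along an injection [folklore] -/
theorem separated_gmap {f : ε → ε'} (hf : Function.Injective f) : ∀ {G : Gen ε}, Separated G → Separated (gmap f G)
  | Gen.born _ _, _ => trivial
  | Gen.renew G _ _, h => separated_gmap hf (G := G) h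
  | Gen.merge X Y e, h => by
      refine ⟨separated_gmap hf h.1, separated_gmap hf h.2.1, ?_⟩
      rw [births_gmap, births_gmap]
      exact disjoint_image hf |>.2 h.2.2

/-- well-formedness pushes forward along an injection (window table `W'` on the target, `W' ∘ f` on the source)
[folklore] -/
theorem wf_gmap {f : ε → ε'} (hf : Function.Injective f) (W' : ε' → ℕ) :
    ∀ {G : Gen ε}, G.WF (W' ∘ f) → (gmap f G).WF W'
  | Gen.born _ _, _ => trivial
  | Gen.renew G e h, hW => by
      obtain ⟨hG, he, h1, h2⟩ := hW
      refine ⟨wf_gmap hf W' hG, ?_, ?_, ?_⟩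
      · rw [events_gmap, mem_image]
        rintro ⟨e₀, he₀, hfe⟩
        exact he (hf hfe ▸ he₀)
      · simpa [gmap] using h1
      · simpa [gmap] using h2
  | Gen.merge X Y e, hW => by
      obtain ⟨hX, hY, heX, heY, hd, h1, h2⟩ := hW
      refine ⟨wf_gmap hf W' hX, wf_gmap hf W' hY, ?_, ?_, ?_, ?_, ?_⟩
      · rw [events_gmap, mem_image]
        rintro ⟨e₀, he₀, hfe⟩
        exact heX (hf hfe ▸ he₀)
      · rw [events_gmap, mem_image]
        rintro ⟨e₀, he₀, hfe⟩
        exact heY (hf hfe ▸ he₀)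
      · rw [events_gmap, events_gmap]
        exact (disjoint_image hf).2 hd
      · simpa [gmap] using h1
      · simpa [gmap] using h2

/-! ## §2 Pull-back to a finite alphabet -/

/-- PULL-BACK of a genealogy on `ε'` whose events lie in a finset `E` to a genealogy on the finite type `↥E`.
[folklore] -/
def grestrict (E : Finset ε') : (G : Gen ε') → G.events ⊆ E → Gen ↥E
  | Gen.born b j, h => Gen.born ⟨b, h (by simp)⟩ j
  | Gen.renew G e k, h =>
      Gen.renew (grestrict E G fun x hx => h (by simp [hx])) ⟨e, h (by simp)⟩ k
  | Gen.merge X Y e, h =>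
      Gen.merge (grestrict E X fun x hx => h (by simp [hx])) (grestrict E Y fun x hx => h (by simp [hx]))
        ⟨e, h (by simp)⟩

/-- **PULL-BACK THEN PUSH-FORWARD IS THE IDENTITY**: `gmap Subtype.val (grestrict E G h) = G`. [folklore] -/
theorem gmap_grestrict (E : Finset ε') : ∀ (G : Gen ε') (h : G.events ⊆ E), gmap Subtype.val (grestrict E G h) = G
  | Gen.born b j, h => rfl
  | Gen.renew G e k, h => by
      simp only [grestrict, gmap]
      rw [gmap_grestrict E G]
  | Gen.merge X Y e, h => by
      simp only [grestrict, gmap]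
      rw [gmap_grestrict E X, gmap_grestrict E Y]

/-! ## §3 Sanity -/

namespace Sanity

/-- mapping the two-leaf merger on `Fin 3` into `ℕ` by `val` -/
theorem gmap_example :
    gmap (fun i : Fin 3 => (i : ℕ)) (Gen.merge (Gen.born 0 0) (Gen.born 1 3) 2) =
      Gen.merge (Gen.born 0 0) (Gen.born 1 3) 2 := rfl

/-- and its exponent is unchanged (`partnerAges = 3 + 1 − 3 = 1` with steps `0 ↦ 0, 1 ↦ 3, 2 ↦ 3`) -/
theorem partnerAges_example :
    partnerAges (fun n : ℕ => if n = 0 then 0 else 3) (gmap (fun i : Fin 3 => (i : ℕ))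
      (Gen.merge (Gen.born 0 0) (Gen.born 1 3) 2)) = 1 := by
  rw [partnerAges_gmap]; decide

end Sanity

end

end Summit.QuantumFields.BalabanUV.T4Continuum.ZoneSkeleton
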